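import Literature.Analysis.FluidPDE.KNSSProp41OfLocal
import Literature.Analysis.FluidPDE.KNSSLocalSmoothingHolds
import HarnessLib

/-!
# KNSS 2009, Proposition 4.1 with (4.6) for restarted bounded mild solutions — discharged

Analysis/FluidPDE glue file **discharging the named fact**
`Literature.Analysis.FluidPDE.KNSS2009_prop41_mild` (`KNSSMildRegularity.lean`; G. Koch,
N. Nadirashvili, G. Seregin, V. Šverák, *Liouville theorems for the Navier–Stokes equations and
applications*, Acta Math. 203 (2009) = arXiv:0709.3599v1, §4 p. 8, Proposition 4.1 with the
quantitative estimate (4.6): for a bounded mild solution with `u₀ ∈ L^∞` the functions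
`t^{k/2+l}∇ᵏₓ∂ₜˡu` are bounded and `‖t^{k/2+l}∇ᵏₓ∂ₜˡu‖_{L^∞(ℝⁿ×(0,T'))} ≤ C(k,l)‖u₀‖_∞` for
`T' = ε(k,l)‖u₀‖_∞^{-2}`; rendered in the tree for the restarted-mild fields `IsKNSSDriftMild T N V 0`
with `l ≤ 1`), by composing two accepted tree theorems:

* `KNSS2009_prop41_mild_of_local` (`KNSSProp41OfLocal.lean`): the fact from the local smoothing
  theory (L) `knss2009_local_smoothing ℝ³` (`NSBoundedMildSmoothing.lean`: Prop. 4.1 in its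
  quantitative short-time form (4.3)–(4.5) for the Oseen integral equation), via the
  heat-flow/kernel bridge, uniqueness of bounded local solutions and the exchange of `∂ₜ` with `∇ᵏₓ`;
* `knss2009_local_smoothing_holds` (`KNSSLocalSmoothingHolds.lean`): the discharge of (L) by the
  weighted Picard iteration (`NSBoundedMildPicardLimit.lean`).

Theorem-only glue module: no definitions, no named facts, no `sorry`. It lives in a sibling file
because `KNSSProp41OfLocal` imports `KNSSMildRegularity` (appending the discharge to the fact's own
file would close an import cycle). With it every `…_of_prop41_mild` reduction of the tree
(`KNSSRegularityWindowOfProp41`, `KNSSThm52OfProp41`, `KNSSTypeIRateLiouvilleOfProp41`) can be fed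
`KNSS2009_prop41_mild_holds` directly.

## References

* G. Koch, N. Nadirashvili, G. Seregin, V. Šverák, *Liouville theorems for the Navier–Stokes
  equations and applications*, Acta Math. 203 (2009) 83–105 = arXiv:0709.3599v1, §4 p. 8:
  (4.3)–(4.6), Proposition 4.1, Remark 4.2. [KochNadirashviliSereginSverak2009]
* Y. Giga, K. Inui, S. Matsui, *On the Cauchy problem for the Navier–Stokes equations with
  nondecaying initial data*, Quaderni di Matematica 4 (1999), Thm. 1 (smoothness of bounded mild
  solutions; KNSS's reference [Giga]).
-/

noncomputable section

namespace Literature.Analysis.FluidPDE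

/-- **KNSS 2009, Proposition 4.1 with (4.6) for restarted bounded mild solutions, PROVED** (the
named statement `KNSS2009_prop41_mild`: joint smoothness on `(0, T) × ℝ³` and, on every short
window `N²(t − s) < ε(k)`, `(t−s)^{k/2}‖∇ᵏV(t)‖ ≤ C(k)N` and
`(t−s)^{k/2+1}‖∇ᵏV(t') − ∇ᵏV(t)‖ ≤ C(k)N(t' − t)`), by `KNSS2009_prop41_mild_of_local` fed with
the discharged local smoothing theory `knss2009_local_smoothing_holds ℝ³`. [cite: KochNadirashviliSereginSverak2009, Prop. 4.1 with (4.6) (arXiv:0709.3599v1 p. 8)] -/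
theorem KNSS2009_prop41_mild_holds : KNSS2009_prop41_mild :=
  KNSS2009_prop41_mild_of_local (knss2009_local_smoothing_holds (EuclideanSpace ℝ (Fin 3)))

end Literature.Analysis.FluidPDE

end
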